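import Summits.ResolutionOfSingularities.ResolutionOfSingularities.Theorems.PurelyInseparableDim4ResConeCInfFrameTools
import Summits.ResolutionOfSingularities.ResolutionOfSingularities.Theorems.PurelyInseparableDim4ResConeExactPairLedger
import Summits.ResolutionOfSingularities.ResolutionOfSingularities.Theorems.PurelyInseparableDim4ResConeCInfSecondTschirnhaus
import Summits.ResolutionOfSingularities.ResolutionOfSingularities.Theorems.PurelyInseparableDim4ResConeCInfSecondTschirnhausFrame
import Summits.ResolutionOfSingularities.ResolutionOfSingularities.Theorems.PurelyInseparableDim4ResConeCInfNoFreeChart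
import Summits.ResolutionOfSingularities.ResolutionOfSingularities.Theorems.PurelyInseparableDim4ResConePowerChain
import HarnessLib
import HarnessLib.Audit.Tags

/-!
# Purely inseparable four-folds — C∞ FRAME ENTRY: from a slot stage of a light `d = 4` chain to a FRAMED window chain
# (straight, exact pair ledger, dead `ū²`-row jet, `u`-axis flag) with the same charts and invariants
# (cell `res-dim4-pi`, K2(p) lane, slice B; C∞ assembly K24c L2b, frame half, part 2)

[OURS · counted 0 · cell `res-dim4-pi` · K2(p) lane holder res-dim4-p-12 g3 (design (iii) «re-frame at ONE state»,
bus 2026-08-29 02:51Z); C∞ assembly owner res-dim4-p-3 g4.]  Nothing here proves K2(p)/K2(5), `NoIsolatedTrap 5 5` or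
resolution of singularities in dimension ≥ 4 / characteristic `p` — NOT proved.  AI kernel work, weaker than expert
review.

**`exists_cInf_window_chain`.**  INPUT: an isolated above-floor witnessed `Step0 5` chain with shade `4` and
`e_G = 3` from `k₀` and its power-cone package (`chain_powerCone_package 5`: `ℓ, a, lam`); fixed letters `λ μ u f`; a
stage `k′ ≥ max(k₀, 1)` from which the ledger is `x_λ x_μ` and the charts are slots (`j m ∈ {λ, μ}`), with
`β k′ λ = β k′ μ = 0`, the contact letter charged (`ℓ_{k′} f ≠ 0`), and both slot letters stretch-born before `k′`.
OUTPUT: a witnessed `Step0 5` chain `c₃` with charts `m ↦ j (k′ + 1 + m)` (the original charts from the NEXT stage on),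
isolated, of order `6`, shade `4`, `e_G = 3`, ledger `x_λ x_μ ∣ F` at every stage, whose start `c₃ 0` is FRAMED:
straight residual cone `a·x_f⁴`, the EXACT pair-ledger support form, the dead `ū²`-row below degree `44`, and the
`u`-axis flag `V(0) ≠ 0` — the start hypotheses of res-dim4-p-2 g4's `cInf_frame_window` (F2c), with the exact ledger
of `…ResConeExactPairLedger` in place of the jet.
ROUTE (all re-framings by res-dim4-p-11 g3's FILE E, dressed in `…CInfTransport` / `…CInfFrameTools`): at `k′`,
re-frame at `f` by the LINEAR straightening `φ_ℓ` (p-11 `tsch_linearForm_straighten`) and at `u` by the linear datum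
`(β k′ u)·x_{j k′}`, which kills the `u`-translation of the first step; that step is then a PURE CORNER step
((VT-f) `translation_contact_eq_zero_of_straight` of res-dim4-p-2 g4 for the `f`-component), so
`…CInfFrameTools.cInf_entry_of_corner` (F3 (i)(ii) + F2a ledger transport + typ-1's (D3) `cInf_uFlag_of_child'`) carries
straightness and the exact ledger (`…ExactPairLedger.lowLedger_frame_of_pair_ledger_linear` over (K11-lin)) to the
next stage AND yields `V(0) ≠ 0` there; res-dim4-typ-1 g3's (E-u) `exists_second_tschirnhaus` then gives the second
Tschirnhaus `ψ` at that stage, and a third re-framing at `u` by `ψ` produces `c₃`.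

[cite: CossartJannsenSaito2020, Thm. 3.14, Lemma 13.2] [cite: Hauser2010, §§F–G] [cite: Kollar2007, Aside 3.57]
bears_on: LADDER-RESOLUTION:D157-DOOR2 (res-dim4-pi · K2(p) slice B · C∞ frame entry).
Supports stmt-ResolutionOfSingularities-16155 (helper).
-/

set_option linter.dupNamespace false -- mandated namespace of this single-conjunct summit

noncomputable section

namespace Summit.ResolutionOfSingularities.ResolutionOfSingularities.Theorems.PIDim4

namespace ResCone

open MvPolynomial Finset FrameChange
open Literature.AlgebraicGeometry.Resolution
open Literature.AlgebraicGeometry.Resolution.CentreBlowup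
open Literature.AlgebraicGeometry.Resolution.Hauser2010
open Literature.AlgebraicGeometry.Resolution.HauserPerlega2019

variable {K : Type} [Field K]

/-- Membership in the support survives un-cleaning: a monomial of `clean P` is a monomial of `P`. [folklore] -/
theorem mem_support_of_mem_support_deletePthPowers [DecidableEq K] (q : ℕ) {P : MvPolynomial (Fin 4) K}
    {d : Fin 4 →₀ ℕ} (hd : d ∈ (deletePthPowers q P).support) : d ∈ P.support := by
  classical
  rw [mem_support_iff] at hd ⊢
  rw [coeff_deletePthPowers] at hd
  split_ifs at hd with h
  · exact absurd rfl hd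
  · exact hd

section Entry

variable [CharP K 5] [DecidableEq K]

/-- **C∞ FRAME ENTRY** (statement and route in the module docstring). [OURS]
[cite: CossartJannsenSaito2020, Thm. 3.14, Lemma 13.2] -/
theorem exists_cInf_window_chain {c : ℕ → State K} {j : ℕ → Fin 4} {β : ℕ → Fin 4 → K}
    (hc : ∀ k, IsIsolated 5 (c k).F ∧ Step0 5 (c k) (c (k + 1))) (hw : FreeTail.IsWitnessedChain 5 c j β)
    (hr0 : ∀ e ∈ (c 0).F.support, (c 0).r ≤ e) (hfloor : ∀ k, ordZero (c k).F ≠ (5 : ℕ)) {k₀ : ℕ}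
    (hshade : ∀ k, k₀ ≤ k → (c k).shade = ((4 : ℕ) : ℕ∞))
    (he3 : ∀ k, k₀ ≤ k → Module.finrank K (resVertex (c k)) = 3)
    {ℓ : ℕ → Fin 4 → K} {a0 lam : ℕ → K}
    (hform : ∀ k, k₀ ≤ k → resForm (c k) = C (a0 k) * (∑ i, C (ℓ k i) * X i) ^ 4)
    (hdir : ∀ k, k₀ ≤ k → ℓ k (j k) + dotProduct (ℓ k) (β k) = 0) (hlam : ∀ k, k₀ ≤ k → lam k ≠ 0)
    (hprop : ∀ k, k₀ ≤ k → ∀ i, i ≠ j k → ℓ (k + 1) i = lam k * ℓ k i)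
    (hcarry : ∀ k, k₀ ≤ k → ∃ i, i ≠ j k ∧ ℓ k i ≠ 0)
    {la mu u f : Fin 4} (hlm : la ≠ mu) (hlu : la ≠ u) (hlf : la ≠ f) (hmu : mu ≠ u) (hmf : mu ≠ f)
    (huf : u ≠ f) {k' : ℕ} (hk' : k₀ ≤ k') (hk1 : 1 ≤ k')
    (hr : ∀ m, k' ≤ m → (c m).r = Finsupp.single la 1 + Finsupp.single mu 1)
    (hj : ∀ m, k' ≤ m → j m = la ∨ j m = mu) (hbla : β k' la = 0) (hbmu : β k' mu = 0)
    (hℓf : ℓ k' f ≠ 0)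
    {ta tb : ℕ} (hta : k₀ ≤ ta) (htak : ta < k') (hja : j ta = la)
    (hkepta : ∀ m, ta < m → m < k' → j m ≠ la ∧ β m la = 0) (htb : k₀ ≤ tb) (htbk : tb < k')
    (hjb : j tb = mu) (hkeptb : ∀ m, tb < m → m < k' → j m ≠ mu ∧ β m mu = 0) :
    ∃ (c₃ : ℕ → State K) (b₃ : ℕ → Fin 4 → K),
      FreeTail.IsWitnessedChain 5 c₃ (fun m => j (k' + 1 + m)) b₃ ∧
      (∀ m, IsIsolated 5 (c₃ m).F ∧ Step0 5 (c₃ m) (c₃ (m + 1))) ∧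
      (∀ m, ordZero (c₃ m).F = (6 : ℕ) ∧ (c₃ m).shade = ((4 : ℕ) : ℕ∞) ∧
        Module.finrank K (resVertex (c₃ m)) = 3 ∧ (c₃ m).r = Finsupp.single la 1 + Finsupp.single mu 1 ∧
        ∀ e ∈ (c₃ m).F.support, (c₃ m).r ≤ e) ∧
      (∃ a : K, a ≠ 0 ∧ resForm (c₃ 0) = C a * X f ^ 4) ∧
      (∀ e ∈ (c₃ 0).F.support, e f ≤ 3 → 2 ≤ e la ∧ 2 ≤ e mu) ∧
      (∀ d ∈ (c₃ 0).F.support, d.degree < 44 → ¬ (d u = 2 ∧ d f = 0)) ∧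
      coeff ((c₃ 0).r + (Finsupp.single la 1 + Finsupp.single mu 1 + Finsupp.single u 3)) (c₃ 0).F ≠ 0 := by
  haveI : Fact (Nat.Prime 5) := ⟨by norm_num⟩
  -- (0) basics on the original chain
  have hdivk : ∀ k, ∀ e ∈ (c k).F.support, (c k).r ≤ e := IsolatedBand.isolated_chain_forall_le hc hr0
  have hrdegm : ∀ m, k' ≤ m → (c m).r.degree = 2 := fun m hm => by
    rw [hr m hm, map_add, Finsupp.degree_single, Finsupp.degree_single]
  have ho6 : ∀ m, k' ≤ m → ordZero (c m).F = ((6 : ℕ) : ℕ∞) := fun m hm => by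
    obtain ⟨o, ho, hpo, -, hod⟩ := chain_shade_nat 5 hc hfloor hshade (hk'.trans hm)
    rw [hrdegm m hm] at hod
    rw [ho]; congr 1; omega
  have hband : ∀ m, k' ≤ m → ∃ o : ℕ, ordZero (c m).F = o ∧ ¬ 5 ∣ o :=
    fun m hm => ⟨6, ho6 m hm, by decide⟩
  have hrf : (c k').r f = 0 := by
    rw [hr k' le_rfl, Finsupp.add_apply, Finsupp.single_eq_of_ne hlf.symm, Finsupp.single_eq_of_ne hmf.symm, add_zero]
  have hru : (c k').r u = 0 := by
    rw [hr k' le_rfl, Finsupp.add_apply, Finsupp.single_eq_of_ne hlu.symm, Finsupp.single_eq_of_ne hmu.symm, add_zero]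
  have hκf : ∀ m, k' ≤ m → j m ≠ f := fun m hm h => by
    rcases hj m hm with h' | h' <;> rw [h] at h'
    · exact hlf.symm h'
    · exact hmf.symm h'
  have hκu : ∀ m, k' ≤ m → j m ≠ u := fun m hm h => by
    rcases hj m hm with h' | h' <;> rw [h] at h'
    · exact hlu.symm h'
    · exact hmu.symm h'
  -- (1) the data: p-11's linear straightening at `f`, and the `u`-translation killer `(β k′ u)·x_{j k′}`
  obtain ⟨hΦvars, hΦ0, -⟩ := straighten_datum_admissible (K := K) (f := f) (ℓ k')
  obtain ⟨hψ₀vars, hψ₀0⟩ := linear_datum_admissible (K := K) (hκu k' le_rfl) (β k' u)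
  have hψ₀hom : (C (β k' u) * X (j k') : MvPolynomial (Fin 4) K).IsHomogeneous 1 := isHomogeneous_C_mul_X _ _
  -- (2) the tail from `k′`, with `f, u` erased from the bookkeeping set
  set c₁ : ℕ → State K := fun m =>
    (⟨(c (k' + m)).F, (c (k' + m)).r, ((c (k' + m)).exc.erase f).erase u⟩ : State K) with hc₁
  have hjf₁ : ∀ m, j (k' + m) ≠ f := fun m => hκf (k' + m) (Nat.le_add_right k' m)
  have hju₁ : ∀ m, j (k' + m) ≠ u := fun m => hκu (k' + m) (Nat.le_add_right k' m)
  have hw₁ : FreeTail.IsWitnessedChain 5 c₁ (fun m => j (k' + m)) (fun m => β (k' + m)) :=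
    isWitnessedChain_eraseExc (isWitnessedChain_eraseExc (isWitnessedChain_shift hw k') (f := f) hjf₁) (f := u) hju₁
  have hclean₁ : deletePthPowers 5 (c₁ 0).F = (c₁ 0).F := by
    obtain ⟨k'', rfl⟩ : ∃ k'', k' = k'' + 1 := ⟨k' - 1, by omega⟩
    show deletePthPowers 5 (c (k'' + 1 + 0)).F = (c (k'' + 1 + 0)).F
    rw [Nat.add_zero, (hw k'').2.2.2.2]
    exact deletePthPowers_step_F 5 Finset.univ (j k'') (β k'') (c k'')
  have hdiv₁ : ∀ m, ∀ e ∈ (c₁ m).F.support, (c₁ m).r ≤ e := fun m => hdivk (k' + m)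
  have hband₁ : ∀ m, ∃ o : ℕ, ordZero (c₁ m).F = o ∧ ¬ 5 ∣ o := fun m => hband (k' + m) (Nat.le_add_right k' m)
  have he₁ : f ∉ (c₁ 0).exc := fun h => Finset.notMem_erase f _ (Finset.mem_of_mem_erase h)
  -- (3) re-frame at `f`
  obtain ⟨φ, b₁, c₁', hφ0, hadm₁, hc₁', hw₁', -, hb₁, hinv₁⟩ :=
    exists_reframed_chain_finrank 5 hw₁ hclean₁ hjf₁ hrf he₁ hdiv₁ hband₁ hΦvars hΦ0
  -- (4) re-frame at `u` with the translation killer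
  have hclean₁' : deletePthPowers 5 (c₁' 0).F = (c₁' 0).F := (hinv₁ 0).2.2.2.2.1
  have hru₁' : (c₁' 0).r u = 0 := by rw [(hinv₁ 0).1]; exact hru
  have heu₁' : u ∉ (c₁' 0).exc := by rw [(hinv₁ 0).2.1]; exact Finset.notMem_erase u _
  have hdiv₁' : ∀ m, ∀ e ∈ (c₁' m).F.support, (c₁' m).r ≤ e := fun m => (hinv₁ m).2.2.2.2.2.2.1
  have hband₁' : ∀ m, ∃ o : ℕ, ordZero (c₁' m).F = o ∧ ¬ 5 ∣ o := fun m => by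
    obtain ⟨o, ho, hpo⟩ := hband₁ m
    exact ⟨o, by rw [(hinv₁ m).2.2.1]; exact ho, hpo⟩
  obtain ⟨ψs, b₂, c₂, hψs0, hadm₂, hb₂f, hc₂, hw₂, hstep₂, hb₂, hinv₂⟩ :=
    exists_reframed_chain_full 5 hw₁' hclean₁' hju₁ hru₁' heu₁' hdiv₁' hband₁' hψ₀vars hψ₀0
  -- (5) invariants of `c₂ m` against `c (k′ + m)`
  have hiso₂ : ∀ m, IsIsolated 5 (c₂ m).F := fun m =>
    (hinv₂ m).2.2.2.2.2.1.mpr ((hinv₁ m).2.2.2.2.2.1.mpr (hc (k' + m)).1)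
  have hc₂' : ∀ m, IsIsolated 5 (c₂ m).F ∧ Step0 5 (c₂ m) (c₂ (m + 1)) := fun m => ⟨hiso₂ m, hstep₂ m⟩
  have hr₂ : ∀ m, (c₂ m).r = Finsupp.single la 1 + Finsupp.single mu 1 := fun m => by
    rw [(hinv₂ m).1, (hinv₁ m).1]; exact hr (k' + m) (Nat.le_add_right k' m)
  have ho₂ : ∀ m, ordZero (c₂ m).F = ((6 : ℕ) : ℕ∞) := fun m => by
    rw [(hinv₂ m).2.2.1, (hinv₁ m).2.2.1]; exact ho6 (k' + m) (Nat.le_add_right k' m)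
  have hshade₂ : ∀ m, 0 ≤ m → (c₂ m).shade = ((4 : ℕ) : ℕ∞) := fun m _ => by
    rw [(hinv₂ m).2.2.2.1, (hinv₁ m).2.2.2.1]; exact hshade (k' + m) (hk'.trans (Nat.le_add_right k' m))
  have he3₂ : ∀ m, 0 ≤ m → Module.finrank K (resVertex (c₂ m)) = 3 := fun m _ => by
    rw [(hinv₂ m).2.2.2.2.2.2.2, (hinv₁ m).2.2.2.2.2.2.2]; exact he3 (k' + m) (hk'.trans (Nat.le_add_right k' m))
  have hdiv₂ : ∀ m, ∀ e ∈ (c₂ m).F.support, (c₂ m).r ≤ e := fun m => (hinv₂ m).2.2.2.2.2.2.1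
  have hfloor₂ : ∀ m, ordZero (c₂ m).F ≠ (5 : ℕ) := fun m => by rw [ho₂ m]; exact_mod_cast (by norm_num : (6 : ℕ) ≠ 5)
  have hr0₂ : ∀ e ∈ (c₂ 0).F.support, (c₂ 0).r ≤ e := hdiv₂ 0
  have hrdeg₂ : ∀ m, (c₂ m).r.degree = 2 := fun m => by
    rw [hr₂ m, map_add, Finsupp.degree_single, Finsupp.degree_single]
  have hrf₂ : ∀ m, (c₂ m).r f = 0 := fun m => by
    rw [hr₂ m, Finsupp.add_apply, Finsupp.single_eq_of_ne hlf.symm, Finsupp.single_eq_of_ne hmf.symm, add_zero]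
  have hru₂ : ∀ m, (c₂ m).r u = 0 := fun m => by
    rw [hr₂ m, Finsupp.add_apply, Finsupp.single_eq_of_ne hlu.symm, Finsupp.single_eq_of_ne hmu.symm, add_zero]
  -- (6) the start state is straight: `resForm (c₂ 0) = A·x_f⁴`
  have hA : a0 k' * ℓ k' f ^ 4 ≠ 0 := straighten_coeff_ne_zero
    (ne_zero_of_resForm_eq_C_mul (ho6 k' le_rfl) (hdivk k') (hform k' hk')) hℓf 4
  have hres₁' : resForm (c₁' 0) = C (a0 k' * ℓ k' f ^ 4) * X f ^ 4 := by
    rw [hc₁' 0, hφ0]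
    exact resForm_cleanTschState_straighten 5 (ho6 k' le_rfl) (by decide) hrf (hdivk k') (hform k' hk') hℓf
  have hres₂0 : resForm (c₂ 0) = C (a0 k' * ℓ k' f ^ 4) * X f ^ 4 := by
    have ho₁' : ordZero (c₁' 0).F = ((6 : ℕ) : ℕ∞) := by rw [(hinv₁ 0).2.2.1]; exact ho6 k' le_rfl
    rw [hc₂ 0, hψs0, resForm_cleanTschState_eq 5 hψ₀vars hψ₀0 ho₁' (by decide),
      resForm_tschState_of_isHomogeneous_one hψ₀vars hψ₀hom hru₁' (hdiv₁' 0), hres₁', map_mul, FrameChange.tsch_C,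
      map_pow, tsch_X_of_ne _ huf.symm]
  -- (7) the first step is a PURE CORNER step: `b₂ 0 = 0`
  obtain ⟨ℓ₂, a₂, lam₂, hpkg₂⟩ := chain_powerCone_package 5 hc₂' hw₂ hr0₂ hfloor₂ (by norm_num) hshade₂ he3₂
  have hb₂0 : b₂ 0 = 0 := by
    obtain ⟨hℓ₂0, -, hform₂0, hchart₂0, -, -, -⟩ := hpkg₂ 0 le_rfl
    have hstr₂ := straight_of_resForm_eq hA hform₂0 hres₂0
    have hbf : b₂ 0 f = 0 := translation_contact_eq_zero_of_straight hℓ₂0 hstr₂ (hjf₁ 0) hchart₂0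
    have hbu : b₂ 0 u = 0 := by
      rw [hb₂f 0, Function.update_apply, if_pos rfl, hb₁ 0 u huf, hψs0, Nat.add_zero,
        eval_chartTransform_one_C_mul_X, sub_self]
    have hbl : b₂ 0 la = 0 := by rw [hb₂ 0 la hlu, hb₁ 0 la hlf, Nat.add_zero]; exact hbla
    have hbm : b₂ 0 mu = 0 := by rw [hb₂ 0 mu hmu, hb₁ 0 mu hmf, Nat.add_zero]; exact hbmu
    funext i
    rcases letters_exhaust hlm hlu hlf hmu hmf huf i with h | h | h | h <;> rw [h, Pi.zero_apply]
    · exact hbl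
    · exact hbm
    · exact hbu
    · exact hbf
  have hstep₂0 : c₂ 1 = CentreBlowup.step 5 Finset.univ (j k') 0 (c₂ 0) := by
    have h := (hw₂ 0).2.2.2.2
    rw [hb₂0, Nat.add_zero] at h
    exact h
  -- (8) the EXACT pair-ledger support form at `c₂ 0`
  have hF₂0 : (c₂ 0).F = deletePthPowers 5 (tsch u (C (β k' u) * X (j k'))
      (deletePthPowers 5 (tsch f (∑ i, C ((fun i => if i = f then (0 : K) else -(ℓ k' i / ℓ k' f)) i) * X i)
        (c k').F))) := by
    rw [hc₂ 0, hψs0, hc₁' 0, hφ0]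
    rfl
  obtain ⟨U, S, T, hU, hledger⟩ := stretch_pair_ledger_linear 5 hc hw hr0 hfloor (by norm_num : 1 ≤ 4) hshade hform
    hdir hlam hprop hcarry hlm hlf.symm hmf.symm hℓf hta htak hja hkepta htb htbk hjb hkeptb
  have hled₂0 : ∀ e ∈ (c₂ 0).F.support, e f ≤ 3 → 2 ≤ e la ∧ 2 ≤ e mu := by
    intro e he hef
    rw [hF₂0] at he
    have h := lowLedger_frame_of_pair_ledger_linear 5 hlu.symm hmu.symm huf hlf hmf (C (β k' u) * X (j k')) hΦ0
      (tsch_linearForm_straighten hℓf) hrf (monomial_mul_divMonomial (hdivk k')).symm hU hledger e he (by omega)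
    rw [hr k' le_rfl] at h
    simp only [Finsupp.add_apply, Finsupp.single_eq_same, Finsupp.single_eq_of_ne hlm,
      Finsupp.single_eq_of_ne (Ne.symm hlm), add_zero, zero_add] at h
    obtain ⟨h1, h2⟩ := h
    exact ⟨by omega, by omega⟩
  -- (9) entry of the pure corner step: straight + exact ledger + V(0) ≠ 0 at `c₂ 1`
  have hiso₂1' : IsIsolated 5 (CentreBlowup.step 5 Finset.univ (j k') 0 (c₂ 0)).F := by
    rw [← hstep₂0]; exact hiso₂ 1
  have ho₂1' : ordZero (CentreBlowup.step 5 Finset.univ (j k') 0 (c₂ 0)).F = (6 : ℕ) := by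
    rw [← hstep₂0]; exact ho₂ 1
  have he3₂1' : Module.finrank K (resVertex (CentreBlowup.step 5 Finset.univ (j k') 0 (c₂ 0))) = 3 := by
    rw [← hstep₂0]; exact he3₂ 1 (Nat.zero_le 1)
  have hdiv₂1' : ∀ e ∈ (CentreBlowup.step 5 Finset.univ (j k') 0 (c₂ 0)).F.support,
      (CentreBlowup.step 5 Finset.univ (j k') 0 (c₂ 0)).r ≤ e := by
    rw [← hstep₂0]; exact hdiv₂ 1
  have hentry : resForm (c₂ 1) = C (a0 k' * ℓ k' f ^ 4) * X f ^ 4 ∧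
      (∀ e ∈ (c₂ 1).F.support, e f ≤ 3 → 2 ≤ e la ∧ 2 ≤ e mu) ∧
      coeff ((c₂ 1).r + (Finsupp.single la 1 + Finsupp.single mu 1 + Finsupp.single u 3)) (c₂ 1).F ≠ 0 := by
    rcases hj k' le_rfl with hκ | hκ
    · have hr₂1' : (CentreBlowup.step 5 Finset.univ (j k') 0 (c₂ 0)).r = Finsupp.single la 1 + Finsupp.single mu 1 := by
        rw [← hstep₂0]; exact hr₂ 1
      rw [hκ] at hiso₂1' ho₂1' he3₂1' hdiv₂1' hr₂1' hstep₂0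
      obtain ⟨h1, h2, -, h4⟩ := cInf_entry_of_corner hlm hlu hlf hmu hmf huf (hr₂ 0) (hdiv₂ 0) (ho₂ 0) hA hres₂0
        hled₂0 hiso₂1' ho₂1' he3₂1' hr₂1' hdiv₂1'
      rw [← hstep₂0] at h1 h2 h4
      exact ⟨h1, h2, h4⟩
    · have hr₂0' : (c₂ 0).r = Finsupp.single mu 1 + Finsupp.single la 1 := by rw [hr₂ 0, add_comm]
      have hr₂1' : (CentreBlowup.step 5 Finset.univ (j k') 0 (c₂ 0)).r = Finsupp.single mu 1 + Finsupp.single la 1 := by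
        rw [← hstep₂0, hr₂ 1, add_comm]
      rw [hκ] at hiso₂1' ho₂1' he3₂1' hdiv₂1' hr₂1' hstep₂0
      obtain ⟨h1, h2, -, h4⟩ := cInf_entry_of_corner (Ne.symm hlm) hmu hmf hlu hlf huf hr₂0' (hdiv₂ 0) (ho₂ 0) hA
        hres₂0 (fun e he hef => (hled₂0 e he hef).symm) hiso₂1' ho₂1' he3₂1' hr₂1' hdiv₂1'
      rw [← hstep₂0] at h1 h2 h4
      refine ⟨h1, fun e he hef => (h2 e he hef).symm, ?_⟩
      rw [show Finsupp.single la 1 + Finsupp.single mu 1 + Finsupp.single u 3 =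
        (Finsupp.single mu 1 + Finsupp.single la 1 + Finsupp.single u 3 : Fin 4 →₀ ℕ) by rw [add_comm (Finsupp.single la 1)]]
      exact h4
  obtain ⟨hres₂1, hled₂1, hV₂1⟩ := hentry
  -- (10) the second Tschirnhaus at `c₂ 1` (res-dim4-typ-1 g3's (E-u))
  have hstr₂1 := straight_readings_of_resForm (ho₂ 1) (hrdeg₂ 1) hres₂1
  obtain ⟨ψ, hψ0, hψu, -, -, hrowψ, hVψ, -⟩ := exists_second_tschirnhaus (K := K) hlm hlu.symm hmu.symm hlf.symm
    hmf.symm huf.symm (G := (c₂ 1).F.divMonomial (c₂ 1).r) (M := 50) three_ne_zero_five (by norm_num)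
    (fun n hnf hnM hn => by
      rw [coeff_divMonomial]
      by_contra hne
      have hmem := mem_support_iff.mpr hne
      have h := hled₂1 _ hmem (by rw [Finsupp.add_apply, hnf, add_zero, hrf₂ 1]; exact Nat.zero_le 3)
      rw [hr₂ 1] at h
      simp only [Finsupp.add_apply, Finsupp.single_eq_same, Finsupp.single_eq_of_ne hlm,
        Finsupp.single_eq_of_ne (Ne.symm hlm), add_zero, zero_add] at h
      obtain ⟨h1, h2⟩ := h
      rcases hn with h0 | h0 <;> omega)
    (by rw [coeff_divMonomial]; exact hV₂1)
    (by
      rw [coeff_divMonomial]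
      refine hstr₂1.2 _ (by simp [map_add, Finsupp.degree_single]) fun h => ?_
      have h' := DFunLike.congr_fun h u
      rw [Finsupp.add_apply, Finsupp.add_apply, Finsupp.single_eq_of_ne hlu.symm, Finsupp.single_eq_of_ne hmu.symm,
        Finsupp.single_eq_same, Finsupp.single_eq_of_ne huf] at h'
      omega)
    40
  -- (11) re-frame at `u` by `ψ`, from `c₂ 1` on
  have hw₂s : FreeTail.IsWitnessedChain 5 (fun m => c₂ (1 + m)) (fun m => j (k' + (1 + m))) (fun m => b₂ (1 + m)) :=
    isWitnessedChain_shift hw₂ 1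
  have hclean₂1 : deletePthPowers 5 (c₂ 1).F = (c₂ 1).F := (hinv₂ 1).2.2.2.2.1
  have hju₂s : ∀ m, j (k' + (1 + m)) ≠ u := fun m => hju₁ (1 + m)
  have heu₂1 : u ∉ (c₂ 1).exc := by
    rw [(hinv₂ 1).2.1, (hinv₁ 1).2.1]
    exact Finset.notMem_erase u _
  have hdiv₂s : ∀ m, ∀ e ∈ (c₂ (1 + m)).F.support, (c₂ (1 + m)).r ≤ e := fun m => hdiv₂ (1 + m)
  have hband₂s : ∀ m, ∃ o : ℕ, ordZero (c₂ (1 + m)).F = o ∧ ¬ 5 ∣ o := fun m => ⟨6, ho₂ (1 + m), by decide⟩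
  obtain ⟨ψq, b₃, c₃, hψq0, hadm₃, hc₃, hw₃, hstep₃, -, hinv₃⟩ :=
    exists_reframed_chain_finrank 5 hw₂s hclean₂1 hju₂s (hru₂ 1) heu₂1 hdiv₂s hband₂s hψu hψ0
  -- (12) conclusion
  have hc₃0 : c₃ 0 = ⟨deletePthPowers 5 (tsch u ψ (c₂ 1).F), (c₂ 1).r, (c₂ 1).exc⟩ := by
    have h := hc₃ 0
    rw [hψq0] at h
    exact h
  have hF₃0 : (c₃ 0).F = deletePthPowers 5 (tsch u ψ (c₂ 1).F) := by rw [hc₃0]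
  have hr₃0 : (c₃ 0).r = (c₂ 1).r := by rw [hc₃0]
  have hG : (c₂ 1).F = monomial (c₂ 1).r 1 * (c₂ 1).F.divMonomial (c₂ 1).r := (monomial_mul_divMonomial (hdiv₂ 1)).symm
  refine ⟨c₃, b₃, ?_, fun m => ⟨?_, hstep₃ m⟩, fun m => ⟨?_, ?_, ?_, ?_, (hinv₃ m).2.2.2.2.2.2.1⟩,
    ⟨_, hA, ?_⟩, ?_, ?_, ?_⟩
  · have hfun : (fun m => j (k' + 1 + m)) = fun m => j (k' + (1 + m)) := funext fun m => by rw [Nat.add_assoc]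
    rw [hfun]; exact hw₃
  · exact (hinv₃ m).2.2.2.2.2.1.mpr (hiso₂ (1 + m))
  · rw [(hinv₃ m).2.2.1]; exact ho₂ (1 + m)
  · rw [(hinv₃ m).2.2.2.1]; exact hshade₂ (1 + m) (Nat.zero_le _)
  · rw [(hinv₃ m).2.2.2.2.2.2.2]; exact he3₂ (1 + m) (Nat.zero_le _)
  · rw [(hinv₃ m).1]; exact hr₂ (1 + m)
  · -- straightness at `c₃ 0`
    rw [hc₃0, resForm_cleanTschState_eq 5 hψu hψ0 (ho₂ 1) (by decide),
      resForm_tschState_eq_tsch_linearPart hψu hψ0 (hru₂ 1) (hdiv₂ 1), hres₂1, map_mul, FrameChange.tsch_C, map_pow,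
      tsch_X_of_ne _ huf.symm]
  · -- exact ledger at `c₃ 0`
    intro e he hef
    rw [hF₃0] at he
    exact lowLedger_deletePthPowers 5 (lowLedger_tsch_of_ne hlu.symm hmu.symm huf ψ (d := 4) (ra := 2) (ra' := 2)
      (fun e he hef => hled₂1 e he (by omega))) e he (by omega)
  · -- the dead `ū²`-row below degree `44`
    intro d hd hd44
    rw [hF₃0, hG, tsch_monomial_mul ψ (hru₂ 1)] at hd
    have hd' := mem_support_of_mem_support_deletePthPowers 5 hd
    exact uRow_support_of_coeff (hru₂ 1) (hrf₂ 1) (B := 45)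
      (fun m h1 h2 h3 => hrowψ m h1 h2 (by omega) (by omega)) hd' (by rw [hrdeg₂ 1]; omega)
  · -- the `u`-axis flag at `c₃ 0`
    rw [hr₃0, hF₃0, hG, tsch_monomial_mul ψ (hru₂ 1), coeff_deletePthPowers, if_neg, coeff_monomial_mul',
      if_pos le_self_add, add_tsub_cancel_left, one_mul, hVψ, coeff_divMonomial]
    · exact hV₂1
    · refine not_isPthPowerExponent_of_not_dvd (i := u) ?_
      rw [Finsupp.add_apply, hru₂ 1, zero_add, Finsupp.add_apply, Finsupp.add_apply, Finsupp.single_eq_of_ne hlu.symm,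
        Finsupp.single_eq_of_ne hmu.symm, Finsupp.single_eq_same]
      decide

end Entry

end ResCone

end Summit.ResolutionOfSingularities.ResolutionOfSingularities.Theorems.PIDim4

end
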